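import Literature.Barriers.CriticalPhenomena.PlanarEdwardsModelDiffusiveScaledPathFdd
import Literature.Barriers.CriticalPhenomena.PlanarEdwardsModelDiffusiveStollProofs
import Literature.Probability.Process.BrownianComplexFddCharFun
import Mathlib.Analysis.InnerProductSpace.PiL2
import Mathlib.Probability.UniformOn
import Mathlib.MeasureTheory.Measure.LevyConvergence
import HarnessLib

/-!
# Convergence of the finite-dimensional distributions of the rescaled planar walk at grid times
# (Donsker, half (D-b): the Lévy step)

Sibling proof file of `Literature.Barriers.CriticalPhenomena.PlanarEdwardsModelDiffusiveStoll`.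
For finitely many times `I₀ ⊆ [0,1]` the laws of the GRID values
`(√(2/n) ω(⌊n t⌋))_{t ∈ I₀}` of the uniform `n`-step planar walk converge weakly, as probability
measures on `I₀ → ℂ`, to the law of `(Z_t)_{t ∈ I₀}` for any planar Brownian motion `Z`
(`Edwards2D.tendsto_expect_gridValues`, stated on bounded continuous test functions): transport to the Euclidean space `ℝ^{I₀ × 2}` (real and
imaginary parts), where Lévy's continuity theorem (Mathlib
`ProbabilityMeasure.tendsto_iff_tendsto_charFun`) applies, the characteristic functions being
computed on both sides (`Edwards2D.tendsto_expect_exp_scaled_pos` for the walk,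
`IsBrownianComplex.integral_exp_I_sum_eq` for the Brownian motion) with the same Gaussian
limit `exp(-σ²/2)`, `σ² = Σ_{t,t'} (v_t · v_{t'}) min(t, t')`; then **Donsker's theorem for the
planar walk** as such (`Edwards2D.tendsto_expect_scaledPath`, tightness + fdd + Prokhorov), and the reduction of the last input (α) of
`Edwards2D.Stoll1989_invariance_of_mollify` to the limits of three second moments
(`Edwards2D.mollify_of_secondMomentLimits`, `Edwards2D.Stoll1989_invariance_of_secondMomentLimits`:
`E M²_{n,k} → E T̄_k²` is Donsker; given `E(J̄_n/2)² → Eγ²` and `E[(J̄_n/2) M_{n,k}] → E[γ T̄_k]`,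
`E(M_{n,k} - J̄_n/2)² → E(T̄_k - γ)² → 0` by Varadhan, and Cauchy–Schwarz).

## References

* P. Billingsley, *Convergence of Probability Measures*, 2nd ed. (1999), proof of Theorem 8.2.
-/

noncomputable section

open MeasureTheory ProbabilityTheory Filter Topology Finset unitInterval
open scoped NNReal ENNReal BigOperators BoundedContinuousFunction

namespace Literature.Barriers.CriticalPhenomena

namespace Edwards2D

open Literature.Probability.Process

universe u

variable (I₀ : Finset I)

/-! ### Real coordinates on `I₀ → ℂ` -/

/-- Real coordinates: `(x_t)_t ↦ (Re x_t, Im x_t)_{(t, j)}` into the Euclidean space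
`ℝ^{I₀ × 2}`, continuous. [folklore] -/
theorem continuous_toEuclidean :
    Continuous fun x : I₀ → ℂ => (WithLp.toLp 2 fun p : I₀ × Fin 2 =>
      if p.2 = 0 then (x p.1).re else (x p.1).im : EuclideanSpace ℝ (I₀ × Fin 2)) := by
  refine (PiLp.continuous_toLp 2 _).comp (continuous_pi fun p => ?_)
  by_cases h : p.2 = 0
  · simp only [h, if_true]; exact Complex.continuous_re.comp (continuous_apply _)
  · simp only [h, if_false]; exact Complex.continuous_im.comp (continuous_apply _)

/-- The inverse: `y ↦ (y_{(t,0)} + i y_{(t,1)})_t`, continuous. [folklore] -/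
theorem continuous_ofEuclidean :
    Continuous fun (y : EuclideanSpace ℝ (I₀ × Fin 2)) (i : I₀) =>
      (⟨y.ofLp (i, 0), y.ofLp (i, 1)⟩ : ℂ) := by
  refine continuous_pi fun i => continuous_complexMk ?_ ?_
  · exact (continuous_apply _).comp (PiLp.continuous_ofLp 2 _)
  · exact (continuous_apply _).comp (PiLp.continuous_ofLp 2 _)

/-- The real-coordinate map is a left inverse of the reassembly. [folklore] -/
theorem ofEuclidean_toEuclidean (x : I₀ → ℂ) :
    (fun (i : I₀) => (⟨(WithLp.toLp 2 fun p : I₀ × Fin 2 =>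
        if p.2 = 0 then (x p.1).re else (x p.1).im : EuclideanSpace ℝ (I₀ × Fin 2)).ofLp (i, 0),
      (WithLp.toLp 2 fun p : I₀ × Fin 2 =>
        if p.2 = 0 then (x p.1).re else (x p.1).im : EuclideanSpace ℝ (I₀ × Fin 2)).ofLp (i, 1)⟩ : ℂ)) = x := by
  funext i
  apply Complex.ext <;> simp

/-- The inner product with the real coordinates of `x` is the linear statistic
`Σ_t (ξ_{(t,0)} Re x_t + ξ_{(t,1)} Im x_t)`. [folklore] -/
theorem inner_toEuclidean (x : I₀ → ℂ) (ξ : EuclideanSpace ℝ (I₀ × Fin 2)) :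
    @inner ℝ _ _ (WithLp.toLp 2 fun p : I₀ × Fin 2 =>
        if p.2 = 0 then (x p.1).re else (x p.1).im : EuclideanSpace ℝ (I₀ × Fin 2)) ξ =
      ∑ i : I₀, (ξ.ofLp (i, 0) * (x i).re + ξ.ofLp (i, 1) * (x i).im) := by
  rw [PiLp.inner_apply, Fintype.sum_prod_type]
  refine Finset.sum_congr rfl fun i _ => ?_
  simp [Fin.sum_univ_two, mul_comm]


/-! ### Uniform averages of complex functions -/

open Literature.Probability.LatticeModels Literature.Probability.Percolation in
/-- Expectation of a complex function under the uniform probability measure on the `4ⁿ` walks is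
the uniform average (`Finset.expect`). [folklore] -/
theorem integral_uniformOn_stepSeq_complex {n : ℕ} (F : StepSeq n → ℂ) :
    ∫ ω, F ω ∂(uniformOn (Set.univ : Set (StepSeq n))) = 𝔼 ω, F ω := by
  rw [integral_fintype (.of_finite), Finset.expect_eq_sum_div_card, Finset.sum_div]
  refine Finset.sum_congr rfl fun ω _ => ?_
  rw [measureReal_def, uniformOn_univ, Measure.count_singleton, Finset.card_univ, ENNReal.toReal_div,
    ENNReal.toReal_one, ENNReal.toReal_natCast, Complex.real_smul, div_eq_inv_mul]
  push_cast
  ring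

/-! ### The Lévy step: weak convergence of the grid values -/

open Literature.Probability.LatticeModels Literature.Probability.Percolation in
/-- **Convergence of the finite-dimensional distributions at grid times** (Donsker, half (D-b),
Lévy step): for finitely many times `I₀ ⊆ [0,1]`, the laws of the grid values
`(√(2/n) ω(⌊n t⌋))_{t ∈ I₀}` of the uniform `n`-step planar walk converge weakly on `I₀ → ℂ` to
the law of `(Z_t)_{t ∈ I₀}`, for every planar Brownian motion `Z` with measurable marginals.
Transport to `ℝ^{I₀ × 2}`, Lévy's continuity theorem, and the two characteristic-function
computations `tendsto_expect_exp_scaled_pos` (walk) and `IsBrownianComplex.integral_exp_I_sum_eq`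
(Brownian motion), which have the same Gaussian limit. [cite: Billingsley1999, proof of Theorem 8.2] -/
theorem tendsto_expect_gridValues {Ω : Type*} [MeasurableSpace Ω] {P : Measure Ω}
    [IsProbabilityMeasure P] {Z : ℝ≥0 → Ω → ℂ} (hZ : IsBrownianComplex Z P)
    (hm : ∀ t, Measurable (Z t)) (φ : (I₀ → ℂ) →ᵇ ℝ) :
    Tendsto (fun n : ℕ => 𝔼 ω : StepSeq n, φ (fun i : I₀ => (Real.sqrt (2 / n) : ℂ) *
        Site.toComplex (pos ω ⌊(n : ℝ) * ((i : I) : ℝ)⌋₊))) atTop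
      (𝓝 (∫ ω, φ (fun i : I₀ => Z (Real.toNNReal ((i : I) : ℝ)) ω) ∂P)) := by
  classical
  -- the coordinate maps
  set T : (I₀ → ℂ) → EuclideanSpace ℝ (I₀ × Fin 2) := fun x => WithLp.toLp 2 fun p : I₀ × Fin 2 =>
    if p.2 = 0 then (x p.1).re else (x p.1).im with hT_def
  set R : EuclideanSpace ℝ (I₀ × Fin 2) → (I₀ → ℂ) := fun y i => ⟨y.ofLp (i, 0), y.ofLp (i, 1)⟩ with hR_def
  have hT : Continuous T := continuous_toEuclidean I₀
  have hR : Continuous R := continuous_ofEuclidean I₀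
  have hRT : ∀ x, R (T x) = x := ofEuclidean_toEuclidean I₀
  -- the random vectors
  set Vn : ∀ n : ℕ, StepSeq n → (I₀ → ℂ) := fun n ω i =>
    (Real.sqrt (2 / n) : ℂ) * Site.toComplex (pos ω ⌊(n : ℝ) * ((i : I) : ℝ)⌋₊) with hVn_def
  set V : Ω → (I₀ → ℂ) := fun ω i => Z (Real.toNNReal ((i : I) : ℝ)) ω with hV_def
  have hVm : Measurable V := measurable_pi_lambda _ fun i => hm _
  have hVnm : ∀ n, Measurable (Vn n) := fun n => Measurable.of_discrete
  -- laws on the Euclidean space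
  set νs : ℕ → ProbabilityMeasure (EuclideanSpace ℝ (I₀ × Fin 2)) := fun n =>
    ⟨(uniformOn (Set.univ : Set (StepSeq n))).map (T ∘ Vn n),
      Measure.isProbabilityMeasure_map (hT.measurable.comp (hVnm n)).aemeasurable⟩ with hνs
  set ν : ProbabilityMeasure (EuclideanSpace ℝ (I₀ × Fin 2)) :=
    ⟨P.map (T ∘ V), Measure.isProbabilityMeasure_map (hT.measurable.comp hVm).aemeasurable⟩ with hν
  -- times and their basic properties
  have ht : ∀ i ∈ (Finset.univ : Finset I₀), 0 ≤ ((i : I) : ℝ) ∧ ((i : I) : ℝ) ≤ 1 :=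
    fun i _ => ⟨(i : I).2.1, (i : I).2.2⟩
  have hτ : ∀ i : I₀, ((Real.toNNReal ((i : I) : ℝ) : ℝ≥0) : ℝ) = ((i : I) : ℝ) :=
    fun i => Real.coe_toNNReal _ (i : I).2.1
  -- Step L: Lévy on the Euclidean space
  have hL : Tendsto νs atTop (𝓝 ν) := by
    rw [ProbabilityMeasure.tendsto_iff_tendsto_charFun]
    intro ξ
    -- the walk side
    have hwalk : ∀ n : ℕ, charFun ((νs n : ProbabilityMeasure _) : Measure _) ξ =
        𝔼 ω : StepSeq n, Complex.exp (Complex.I *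
          ((∑ i ∈ (Finset.univ : Finset I₀), ∑ j, (Real.sqrt (2 / n) * ξ.ofLp (i, j)) *
            (pos ω ⌊(n : ℝ) * ((i : I) : ℝ)⌋₊ j : ℝ) : ℝ) : ℂ)) := by
      intro n
      simp only [hνs, ProbabilityMeasure.coe_mk]
      rw [charFun_apply, integral_map (hT.measurable.comp (hVnm n)).aemeasurable (by fun_prop),
        integral_uniformOn_stepSeq_complex]
      refine Finset.expect_congr rfl fun ω _ => ?_
      simp only [Function.comp_apply, hT_def, inner_toEuclidean]
      rw [mul_comm]
      congr 2
      push_cast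
      refine Finset.sum_congr rfl fun i _ => ?_
      simp only [hVn_def, Fin.sum_univ_two, Complex.mul_re, Complex.mul_im, Complex.ofReal_re,
        Complex.ofReal_im, Site.toComplex_re, Site.toComplex_im, zero_mul, sub_zero, add_zero]
      push_cast
      ring
    -- the Brownian side
    have hbm : charFun ((ν : ProbabilityMeasure _) : Measure _) ξ =
        ((Real.exp (-((∑ i ∈ (Finset.univ : Finset I₀), ∑ i' ∈ (Finset.univ : Finset I₀),
          (∑ j : Fin 2, ξ.ofLp (i, j) * ξ.ofLp (i', j)) * min ((i : I) : ℝ) ((i' : I) : ℝ)) / 2)) : ℝ) : ℂ) := by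
      simp only [hν, ProbabilityMeasure.coe_mk]
      rw [charFun_apply, integral_map (hT.measurable.comp hVm).aemeasurable (by fun_prop)]
      have e1 : ∀ ω, Complex.exp ((@inner ℝ _ _ ((T ∘ V) ω) ξ : ℂ) * Complex.I) =
          Complex.exp (Complex.I * ((∑ i ∈ (Finset.univ : Finset I₀),
            (ξ.ofLp (i, 0) * (Z (Real.toNNReal ((i : I) : ℝ)) ω).re +
              ξ.ofLp (i, 1) * (Z (Real.toNNReal ((i : I) : ℝ)) ω).im) : ℝ) : ℂ)) := by
        intro ω
        have hin : @inner ℝ _ _ ((T ∘ V) ω) ξ = ∑ i : I₀, (ξ.ofLp (i, 0) * (V ω i).re +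
            ξ.ofLp (i, 1) * (V ω i).im) := inner_toEuclidean I₀ (V ω) ξ
        rw [hin, mul_comm]
      simp_rw [e1]
      rw [hZ.integral_exp_I_sum_eq hm Finset.univ (fun i j => ξ.ofLp (i, j))
        (fun i => Real.toNNReal ((i : I) : ℝ))]
      simp only [hτ, Fin.sum_univ_two]
    simp_rw [hwalk, hbm]
    exact tendsto_expect_exp_scaled_pos Finset.univ (fun i j => ξ.ofLp (i, j)) (fun i => ((i : I) : ℝ)) ht
  -- Step P: pull back along `R`
  have hP := ProbabilityMeasure.tendsto_map_of_tendsto_of_continuous νs ν hL hR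
  have e_n : ∀ n, (νs n).map hR.measurable.aemeasurable =
      (⟨(uniformOn (Set.univ : Set (StepSeq n))).map (Vn n),
        Measure.isProbabilityMeasure_map (hVnm n).aemeasurable⟩ : ProbabilityMeasure (I₀ → ℂ)) := by
    intro n
    apply ProbabilityMeasure.toMeasure_injective
    simp only [ProbabilityMeasure.toMeasure_map, hνs, ProbabilityMeasure.coe_mk]
    have hcomp : R ∘ (T ∘ Vn n) = Vn n := funext fun ω => hRT _
    rw [Measure.map_map hR.measurable (hT.measurable.comp (hVnm n)), hcomp]
  have e_lim : ν.map hR.measurable.aemeasurable =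
      (⟨P.map V, Measure.isProbabilityMeasure_map hVm.aemeasurable⟩ : ProbabilityMeasure (I₀ → ℂ)) := by
    apply ProbabilityMeasure.toMeasure_injective
    simp only [ProbabilityMeasure.toMeasure_map, hν, ProbabilityMeasure.coe_mk]
    have hcomp : R ∘ (T ∘ V) = V := funext fun ω => hRT _
    rw [Measure.map_map hR.measurable (hT.measurable.comp hVm), hcomp]
  simp_rw [e_n, e_lim] at hP
  have := (ProbabilityMeasure.tendsto_iff_forall_integral_tendsto.1 hP) φ
  simp only [ProbabilityMeasure.coe_mk] at this
  rw [integral_map hVm.aemeasurable φ.continuous.aestronglyMeasurable] at this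
  refine (tendsto_congr fun n => ?_).1 this
  rw [integral_map (hVnm n).aemeasurable φ.continuous.aestronglyMeasurable]
  exact integral_uniformOn_stepSeq _


/-! ### From grid values to the polygonal path, and the assembly of (D-b) -/

section Transfer

variable {Ωs : ℕ → Type*} [∀ n, MeasurableSpace (Ωs n)] {Q : ∀ n, Measure (Ωs n)}
  [∀ n, IsProbabilityMeasure (Q n)] {Ω' : Type*} [MeasurableSpace Ω'] {P : Measure Ω'}
  [IsProbabilityMeasure P] {M : Type*} [PseudoMetricSpace M] [MeasurableSpace M]
  [OpensMeasurableSpace M] {A B : ∀ n, Ωs n → M} {B' : Ω' → M}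

/-- **Deterministically close random elements have the same limit in law** (varying probability
spaces): if `dist(A_n, B_n) ≤ ε_n → 0` pointwise and `B_n → B'` in law, then `A_n → B'` in law
(bounded continuous test functions; bounded-Lipschitz reduction). [cite: Billingsley1999, Theorem 3.1] -/
theorem tendsto_integral_comp_of_dist_le (hA : ∀ n, AEMeasurable (A n) (Q n))
    (hB : ∀ n, AEMeasurable (B n) (Q n)) (hB' : AEMeasurable B' P) {ε : ℕ → ℝ}
    (hε : Tendsto ε atTop (𝓝 0)) (hclose : ∀ n ω, dist (A n ω) (B n ω) ≤ ε n)
    (hlaw : ∀ φ : M →ᵇ ℝ, Tendsto (fun n => ∫ ω, φ (B n ω) ∂Q n) atTop (𝓝 (∫ ω, φ (B' ω) ∂P)))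
    (φ : M →ᵇ ℝ) :
    Tendsto (fun n => ∫ ω, φ (A n ω) ∂Q n) atTop (𝓝 (∫ ω, φ (B' ω) ∂P)) := by
  set μA : ℕ → ProbabilityMeasure M :=
    fun n => ⟨(Q n).map (A n), Measure.isProbabilityMeasure_map (hA n)⟩ with hμA
  set μB : ℕ → ProbabilityMeasure M :=
    fun n => ⟨(Q n).map (B n), Measure.isProbabilityMeasure_map (hB n)⟩ with hμB
  set μ : ProbabilityMeasure M := ⟨P.map B', Measure.isProbabilityMeasure_map hB'⟩ with hμ
  have hBt : Tendsto μB atTop (𝓝 μ) := by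
    rw [ProbabilityMeasure.tendsto_iff_forall_integral_tendsto]
    intro ψ
    simp only [hμB, hμ, ProbabilityMeasure.coe_mk]
    rw [integral_map hB' ψ.continuous.aestronglyMeasurable]
    refine (tendsto_congr fun n => ?_).2 (hlaw ψ)
    rw [integral_map (hB n) ψ.continuous.aestronglyMeasurable]
  suffices hAt : Tendsto μA atTop (𝓝 μ) by
    have := (ProbabilityMeasure.tendsto_iff_forall_integral_tendsto.1 hAt) φ
    simp only [hμA, hμ, ProbabilityMeasure.coe_mk] at this
    rw [integral_map hB' φ.continuous.aestronglyMeasurable] at this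
    refine (tendsto_congr fun n => ?_).1 this
    rw [integral_map (hA n) φ.continuous.aestronglyMeasurable]
  rw [tendsto_iff_forall_lipschitz_integral_tendsto] at hBt ⊢
  rintro f ⟨C, hC⟩ ⟨L, hL⟩
  have hBf := hBt f ⟨C, hC⟩ ⟨L, hL⟩
  simp only [hμA, hμB, hμ, ProbabilityMeasure.coe_mk] at hBf ⊢
  simp_rw [integral_map (hA _) hL.continuous.aestronglyMeasurable]
  simp_rw [integral_map (hB _) hL.continuous.aestronglyMeasurable] at hBf
  -- `∫ f(A_n) - ∫ f(B_n) → 0`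
  rcases isEmpty_or_nonempty M with hM | ⟨⟨x₀⟩⟩
  · have : ∀ n, (fun ω => f (A n ω)) = fun ω => f (B n ω) := fun n =>
      funext fun ω => (hM.false (A n ω)).elim
    simp_rw [this]; exact hBf
  have hbd : ∀ y, ‖f y‖ ≤ ‖f x₀‖ + C := fun y => by
    have h1 := hC y x₀
    rw [Real.dist_eq] at h1
    have h2 := abs_add_le (f x₀) (f y - f x₀)
    rw [add_sub_cancel] at h2
    exact h2.trans (add_le_add le_rfl h1)
  have hdiff : Tendsto (fun n => ∫ ω, f (A n ω) ∂Q n - ∫ ω, f (B n ω) ∂Q n) atTop (𝓝 0) := by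
    rw [tendsto_zero_iff_abs_tendsto_zero]
    have hεabs : Tendsto (fun n => (L : ℝ) * |ε n|) atTop (𝓝 0) := by
      simpa using ((tendsto_zero_iff_abs_tendsto_zero _).1 hε).const_mul (L : ℝ)
    refine squeeze_zero' (Eventually.of_forall fun n => abs_nonneg _) (Eventually.of_forall fun n => ?_)
      hεabs
    simp only [Function.comp_apply]
    rw [← integral_sub (integrable_comp_of_lipschitz_of_bounded (hA n) hL hbd)
      (integrable_comp_of_lipschitz_of_bounded (hB n) hL hbd)]
    refine (abs_integral_le_integral_abs).trans ?_
    refine (integral_mono_of_nonneg (ae_of_all _ fun _ => abs_nonneg _) (integrable_const _)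
      (ae_of_all _ fun ω => ?_)).trans (by rw [integral_const, probReal_univ, one_smul])
    calc |f (A n ω) - f (B n ω)| = dist (f (A n ω)) (f (B n ω)) := (Real.dist_eq _ _).symm
      _ ≤ L * dist (A n ω) (B n ω) := hL.dist_le_mul _ _
      _ ≤ L * |ε n| := by gcongr; exact (hclose n ω).trans (le_abs_self _)
  have := hdiff.add hBf
  simp only [zero_add, sub_add_cancel] at this
  exact this

end Transfer

open Literature.Probability.LatticeModels Literature.Probability.Percolation in
/-- The polygonal path at a time `t ∈ [0,1]` is within two lattice spacings of the grid value
`√(2/n) ω(⌊nt⌋)`. [folklore] -/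
theorem norm_scaledPath_sub_gridValue_le {n : ℕ} (hn : 0 < n) (ω : StepSeq n) (t : I) :
    ‖scaledPath n ω t - (Real.sqrt (2 / n) : ℂ) * Site.toComplex (pos ω ⌊(n : ℝ) * (t : ℝ)⌋₊)‖ ≤
      2 * Real.sqrt (2 / n) := by
  obtain ⟨j, hj, hj1, hj2⟩ := exists_cell hn t
  have e1 := norm_scaledPath_sub_grid_le ω hj t hj1 hj2
  -- `⌊nt⌋ ∈ {j, j+1}`, so the two grid points differ by at most one step
  have hfl : ⌊(n : ℝ) * (t : ℝ)⌋₊ = j ∨ ⌊(n : ℝ) * (t : ℝ)⌋₊ = j + 1 := by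
    have h1 : j ≤ ⌊(n : ℝ) * (t : ℝ)⌋₊ := Nat.le_floor hj1
    have h2 : ⌊(n : ℝ) * (t : ℝ)⌋₊ ≤ j + 1 := by
      refine Nat.floor_le_of_le ?_; push_cast; exact hj2
    omega
  have e2 : ‖(Real.sqrt (2 / n) : ℂ) * Site.toComplex (pos ω j) -
      (Real.sqrt (2 / n) : ℂ) * Site.toComplex (pos ω ⌊(n : ℝ) * (t : ℝ)⌋₊)‖ ≤ Real.sqrt (2 / n) := by
    rw [← mul_sub, norm_mul, Complex.norm_real, Real.norm_of_nonneg (Real.sqrt_nonneg _)]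
    refine mul_le_of_le_one_right (Real.sqrt_nonneg _) ?_
    rcases hfl with h | h
    · rw [h, sub_self, norm_zero]; exact zero_le_one
    · rw [h, pos_succ ω hj]
      have : Site.toComplex (pos ω j) - Site.toComplex (pos ω j + stepVec (ω ⟨j, hj⟩)) =
          -Site.toComplex (stepVec (ω ⟨j, hj⟩)) := by
        apply Complex.ext <;> simp
      rw [this, norm_neg, norm_toComplex_stepVec]
  calc ‖scaledPath n ω t - (Real.sqrt (2 / n) : ℂ) * Site.toComplex (pos ω ⌊(n : ℝ) * (t : ℝ)⌋₊)‖
      = ‖(scaledPath n ω t - (Real.sqrt (2 / n) : ℂ) * Site.toComplex (pos ω j)) +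
          ((Real.sqrt (2 / n) : ℂ) * Site.toComplex (pos ω j) -
            (Real.sqrt (2 / n) : ℂ) * Site.toComplex (pos ω ⌊(n : ℝ) * (t : ℝ)⌋₊))‖ := by
        congr 1; ring
    _ ≤ Real.sqrt (2 / n) + Real.sqrt (2 / n) := (norm_add_le _ _).trans (add_le_add e1 e2)
    _ = 2 * Real.sqrt (2 / n) := by ring

open Literature.Probability.LatticeModels Literature.Probability.Percolation in
/-- **Convergence of the finite-dimensional distributions of the rescaled polygonal walks**
(Donsker, half (D-b), complete): for finitely many times `I₀ ⊆ [0,1]` and every planar Brownian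
motion `Z`, `𝔼 φ((W̄_n(t))_{t ∈ I₀}) → E φ((Z_t)_{t ∈ I₀})` for bounded continuous `φ` — the
hypothesis `hfdd` of `Stoll1989_invariance_of_fdd_of_mollify`. From the grid values
(`tendsto_expect_gridValues`) by the deterministic bound `norm_scaledPath_sub_gridValue_le`.
[cite: Billingsley1999, Theorem 8.2] -/
theorem tendsto_expect_fdd_scaledPath (I₀ : Finset I) {Ω : Type*} [MeasurableSpace Ω]
    (P : Measure Ω) [IsProbabilityMeasure P] (Z : ℝ≥0 → Ω → ℂ) (hZ : IsBrownianComplex Z P)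
    (hm : ∀ t, Measurable (Z t)) (φ : (I₀ → ℂ) →ᵇ ℝ) :
    Tendsto (fun n : ℕ => 𝔼 ω : StepSeq n, φ fun i : I₀ => scaledPath n ω i) atTop
      (𝓝 (∫ ω, φ (fun i : I₀ => Z (Real.toNNReal ((i : I) : ℝ)) ω) ∂P)) := by
  have key := tendsto_integral_comp_of_dist_le (M := I₀ → ℂ)
    (Q := fun n => uniformOn (Set.univ : Set (StepSeq n))) (P := P)
    (A := fun n (ω : StepSeq n) (i : I₀) => scaledPath n ω i)
    (B := fun n (ω : StepSeq n) (i : I₀) => (Real.sqrt (2 / n) : ℂ) *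
      Site.toComplex (pos ω ⌊(n : ℝ) * ((i : I) : ℝ)⌋₊))
    (B' := fun ω (i : I₀) => Z (Real.toNNReal ((i : I) : ℝ)) ω)
    (fun n => (Measurable.of_discrete).aemeasurable) (fun n => (Measurable.of_discrete).aemeasurable)
    (measurable_pi_lambda _ fun i => hm _).aemeasurable (ε := fun n => 2 * Real.sqrt (2 / n)) ?_ ?_
    (fun ψ => by
      have := tendsto_expect_gridValues I₀ hZ hm ψ
      refine (tendsto_congr fun n => ?_).1 this
      exact (integral_uniformOn_stepSeq _).symm) φ
  · refine (tendsto_congr fun n => ?_).1 key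
    exact integral_uniformOn_stepSeq _
  · -- `2 √(2/n) → 0`
    have h : Tendsto (fun n : ℕ => Real.sqrt (2 / n)) atTop (𝓝 0) := by
      have h2 : Tendsto (fun n : ℕ => (2 : ℝ) / n) atTop (𝓝 0) :=
        tendsto_const_div_atTop_nhds_zero_nat 2
      have := (Real.continuous_sqrt.tendsto 0).comp h2
      rwa [Real.sqrt_zero] at this
    simpa using h.const_mul 2
  · intro n ω
    rw [dist_pi_le_iff (by positivity)]
    intro i
    rcases Nat.eq_zero_or_pos n with rfl | hn
    · simp [scaledPath]
    · rw [dist_eq_norm]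
      exact norm_scaledPath_sub_gridValue_le hn ω i

/-- **Stoll's invariance principle from the discrete renormalisation estimate alone.** With
(D-a) tightness (`isTightMeasureSet_scaledPath`) and (D-b) convergence of the finite-dimensional
distributions (`tendsto_expect_fdd_scaledPath`) PROVED — i.e. Donsker's theorem for the planar
walk — the named fact `Stoll1989_invariance` follows from the single remaining input
(α): the uniform-in-`n` `L¹` approximation of `J̄_n/2 = (J - ⟨J⟩)/n` by the centred Gaussian
mollifications of the rescaled walk (the random-walk half of Varadhan's renormalisation,
Thm. 2.4/Cor. 2.5 and Thm. 15 of the source). [cite: Stoll1989, §§2–3] [cite: Billingsley1999, Theorem 8.2] -/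
theorem Stoll1989_invariance_of_mollify
    (hα : ∀ ε : ℝ, 0 < ε → ∀ᶠ k : ℕ in atTop, ∀ᶠ n : ℕ in atTop,
      𝔼 ω : StepSeq n, |((∫ s in Set.Icc (0 : ℝ) 1, ∫ t in Set.Icc (0 : ℝ) 1,
        gaussKernel k ((scaledPath n ω) (Set.projIcc (0 : ℝ) 1 zero_le_one s) -
          (scaledPath n ω) (Set.projIcc (0 : ℝ) 1 zero_le_one t))) -
        𝔼 ω' : StepSeq n, (∫ s in Set.Icc (0 : ℝ) 1, ∫ t in Set.Icc (0 : ℝ) 1,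
        gaussKernel k ((scaledPath n ω') (Set.projIcc (0 : ℝ) 1 zero_le_one s) -
          (scaledPath n ω') (Set.projIcc (0 : ℝ) 1 zero_le_one t)))) -
        jbar n ω / 2| ≤ ε) :
    Stoll1989_invariance.{u} :=
  Stoll1989_invariance_of_fdd_of_mollify
    (fun I₀ _ _ P _ Z hZ hm _ φ => tendsto_expect_fdd_scaledPath I₀ P Z hZ hm φ) hα


/-! ### Donsker's theorem for the planar simple random walk (both halves assembled) -/

/-- **Donsker's invariance principle for the planar simple random walk, PROVED**: for every
planar Brownian motion `Z` (measurable marginals, continuous paths) on a probability space and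
every bounded continuous `ψ : C([0,1], ℂ) → ℝ`, the uniform averages `𝔼 ψ(W̄_n)` of `ψ` over the
polygonal paths of the `4ⁿ` walks, diffusively rescaled (`Δx = √(2Δt) = √(2/n)`), converge to
`E ψ(t ↦ Z_t)`. Tightness (`isTightMeasureSet_scaledPath`), finite-dimensional convergence
(`tendsto_expect_fdd_scaledPath`) and Prokhorov (`donsker_of_isTightMeasureSet_of_tendsto_fdd`).
[cite: Billingsley1999, Theorem 8.2] -/
theorem tendsto_expect_scaledPath (Ω : Type u) [MeasurableSpace Ω] (P : Measure Ω)
    [IsProbabilityMeasure P] (Z : ℝ≥0 → Ω → ℂ) (hZ : IsBrownianComplex Z P)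
    (hm : ∀ t, Measurable (Z t)) (hc : ∀ ω, Continuous (Z · ω)) (ψ : C(I, ℂ) →ᵇ ℝ) :
    Tendsto (fun n => 𝔼 ω : StepSeq n, ψ (scaledPath n ω)) atTop
      (𝓝 (∫ ω, ψ ((⟨fun t : I => Z (Real.toNNReal (t : ℝ)) ω,
        (hc ω).comp (continuous_real_toNNReal.comp continuous_subtype_val)⟩ : C(I, ℂ))) ∂P)) :=
  donsker_of_isTightMeasureSet_of_tendsto_fdd isTightMeasureSet_scaledPath
    (fun I₀ _ _ P _ Z hZ hm _ φ => tendsto_expect_fdd_scaledPath I₀ P Z hZ hm φ) Ω P Z hZ hm hc ψ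


open Literature.Probability.LatticeModels Literature.Probability.Percolation

/-! ### Core (α) from the limits of three second moments

`E|M_{n,k} - D_n| ≤ (E(M_{n,k} - D_n)²)^{1/2}` and
`E(M_{n,k} - D_n)² = E M²_{n,k} - 2 E[D_n M_{n,k}] + E D_n²` (both centred), where `D_n = J̄_n/2`
and `M_{n,k} = Φ_k(W̄_n) - ⟨Φ_k(W̄_n)⟩`. By Donsker (`tendsto_expect_scaledPath`) `E M²_{n,k} →
E T̄_k²` (`T̄_k = T_k - E T_k` the centred mollified self-intersection local time of a planar
Brownian motion); so if `E D_n² → E γ²` and `E[D_n M_{n,k}] → E[γ T̄_k]` for an `L²` limit `γ` of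
the `T̄_k` (Varadhan), then `E(M_{n,k} - D_n)² → E(T̄_k - γ)² → 0` (`k → ∞`). -/

/-- `𝔼 (F - 𝔼F)² = 𝔼 F² - (𝔼 F)²` for uniform averages. [folklore] -/
theorem expect_sq_sub_expect {ι : Type*} [Fintype ι] [Nonempty ι] (F : ι → ℝ) :
    𝔼 i, (F i - 𝔼 j, F j) ^ 2 = 𝔼 i, F i ^ 2 - (𝔼 j, F j) ^ 2 := by
  have h : ∀ i, (F i - 𝔼 j, F j) ^ 2 = F i ^ 2 - 2 * (𝔼 j, F j) * F i + (𝔼 j, F j) ^ 2 := fun i => by ring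
  simp_rw [h, Finset.expect_add_distrib, Finset.expect_sub_distrib, ← Finset.mul_expect,
    Finset.expect_const Finset.univ_nonempty]
  ring

/-- `𝔼 ((F - 𝔼F) - D)² = 𝔼 (F - 𝔼F)² - 2 𝔼 D (F - 𝔼F) + 𝔼 D²`. [folklore] -/
theorem expect_sq_centred_sub {ι : Type*} [Fintype ι] [Nonempty ι] (F D : ι → ℝ) :
    𝔼 i, ((F i - 𝔼 j, F j) - D i) ^ 2 =
      𝔼 i, (F i - 𝔼 j, F j) ^ 2 - 2 * 𝔼 i, D i * (F i - 𝔼 j, F j) + 𝔼 i, D i ^ 2 := by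
  have h : ∀ i, ((F i - 𝔼 j, F j) - D i) ^ 2 =
      (F i - 𝔼 j, F j) ^ 2 - 2 * (D i * (F i - 𝔼 j, F j)) + D i ^ 2 := fun i => by ring
  simp_rw [h, Finset.expect_add_distrib, Finset.expect_sub_distrib, ← Finset.mul_expect]

/-- Cauchy–Schwarz for uniform averages: `𝔼 |X| ≤ (𝔼 X²)^{1/2}`. [folklore] -/
theorem expect_abs_le_sqrt_expect_sq {ι : Type*} [Fintype ι] [Nonempty ι] (X : ι → ℝ) :
    𝔼 i, |X i| ≤ Real.sqrt (𝔼 i, X i ^ 2) := by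
  have h := expect_mul_le_sqrt (s := (Finset.univ : Finset ι)) (fun i => |X i|) (fun _ => (1 : ℝ))
  simp only [mul_one, one_pow, Finset.expect_const Finset.univ_nonempty, Real.sqrt_one, sq_abs] at h
  exact h

/-- **Core (α) from the limits of the second moments.** Let `(Z₀, γ₀)` be a planar Brownian
motion with an `L²` limit `γ₀` of its centred mollified self-intersection local times
`T̄_k = T_k - E T_k` (Varadhan; e.g. the canonical one). If (α₁) `E (J̄_n/2)² → E γ₀²` and (α₂)
`E[(J̄_n/2)(Φ_k(W̄_n) - ⟨Φ_k(W̄_n)⟩)] → E[γ₀ T̄_k]` for every `k`, then the discrete renormalisation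
estimate (α) holds: by Donsker `E(Φ_k(W̄_n) - ⟨Φ_k(W̄_n)⟩)² → E T̄_k²`, so
`E((Φ_k(W̄_n) - ⟨·⟩) - J̄_n/2)² → E(T̄_k - γ₀)² → 0`, and Cauchy–Schwarz.
[cite: Stoll1989, §2 (Thm. 2.4, Cor. 2.5) and BiBoS II Thm. 15] -/
theorem mollify_of_secondMomentLimits {Ω₀ : Type u} [MeasurableSpace Ω₀] (P₀ : Measure Ω₀)
    [IsProbabilityMeasure P₀] (Z₀ : ℝ≥0 → Ω₀ → ℂ) (hZ₀ : IsBrownianComplex Z₀ P₀)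
    (hm₀ : ∀ t, Measurable (Z₀ t)) (hc₀ : ∀ ω, Continuous (Z₀ · ω)) (γ₀ : Ω₀ → ℝ)
    (hγ₀ : MemLp γ₀ 2 P₀)
    (hlim₀ : Tendsto (fun k : ℕ => eLpNorm (fun ω =>
      (mollifiedSILT Z₀ k ω - ∫ ω', mollifiedSILT Z₀ k ω' ∂P₀) - γ₀ ω) 2 P₀) atTop (𝓝 0))
    (hα₁ : Tendsto (fun n : ℕ => 𝔼 ω : StepSeq n, (jbar n ω / 2) ^ 2) atTop
      (𝓝 (∫ ω, γ₀ ω ^ 2 ∂P₀)))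
    (hα₂ : ∀ k : ℕ, Tendsto (fun n : ℕ => 𝔼 ω : StepSeq n, (jbar n ω / 2) *
        ((∫ s in Set.Icc (0 : ℝ) 1, ∫ t in Set.Icc (0 : ℝ) 1,
        gaussKernel k ((scaledPath n ω) (Set.projIcc (0 : ℝ) 1 zero_le_one s) -
          (scaledPath n ω) (Set.projIcc (0 : ℝ) 1 zero_le_one t))) - 𝔼 ω' : StepSeq n, (∫ s in Set.Icc (0 : ℝ) 1, ∫ t in Set.Icc (0 : ℝ) 1,
        gaussKernel k ((scaledPath n ω') (Set.projIcc (0 : ℝ) 1 zero_le_one s) -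
          (scaledPath n ω') (Set.projIcc (0 : ℝ) 1 zero_le_one t))))) atTop
      (𝓝 (∫ ω, γ₀ ω * (mollifiedSILT Z₀ k ω - ∫ ω', mollifiedSILT Z₀ k ω' ∂P₀) ∂P₀))) :
    ∀ ε : ℝ, 0 < ε → ∀ᶠ k : ℕ in atTop, ∀ᶠ n : ℕ in atTop,
      𝔼 ω : StepSeq n, |((∫ s in Set.Icc (0 : ℝ) 1, ∫ t in Set.Icc (0 : ℝ) 1,
        gaussKernel k ((scaledPath n ω) (Set.projIcc (0 : ℝ) 1 zero_le_one s) -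
          (scaledPath n ω) (Set.projIcc (0 : ℝ) 1 zero_le_one t))) - 𝔼 ω' : StepSeq n, (∫ s in Set.Icc (0 : ℝ) 1, ∫ t in Set.Icc (0 : ℝ) 1,
        gaussKernel k ((scaledPath n ω') (Set.projIcc (0 : ℝ) 1 zero_le_one s) -
          (scaledPath n ω') (Set.projIcc (0 : ℝ) 1 zero_le_one t)))) - jbar n ω / 2| ≤ ε := by
  intro ε hε
  set path₀ : Ω₀ → C(I, ℂ) := fun ω => ⟨fun t : I => Z₀ (Real.toNNReal (t : ℝ)) ω,
    (hc₀ ω).comp (continuous_real_toNNReal.comp continuous_subtype_val)⟩ with hpath₀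
  have hpath₀m : Measurable path₀ := measurable_pathMap Z₀ hm₀ hc₀
  -- the mollified functional as a bounded continuous function, and `T_k = Φ_k ∘ path`
  have hT : ∀ k ω, mollifiedSILT Z₀ k ω = (∫ s in Set.Icc (0 : ℝ) 1, ∫ t in Set.Icc (0 : ℝ) 1,
      gaussKernel k ((path₀ ω) (Set.projIcc (0 : ℝ) 1 zero_le_one s) -
        (path₀ ω) (Set.projIcc (0 : ℝ) 1 zero_le_one t))) := fun k ω =>
    mollifiedSILT_eq_mollify_path Z₀ hc₀ k ω
  have hΨ : ∀ k : ℕ, ∃ Ψ : C(I, ℂ) →ᵇ ℝ, ∀ p, Ψ p = (∫ s in Set.Icc (0 : ℝ) 1, ∫ t in Set.Icc (0 : ℝ) 1,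
      gaussKernel k (p (Set.projIcc (0 : ℝ) 1 zero_le_one s) - p (Set.projIcc (0 : ℝ) 1 zero_le_one t))) := by
    intro k
    obtain ⟨Ψ, hΨ⟩ := exists_boundedContinuous_mollify k 1
    exact ⟨Ψ, fun p => by rw [hΨ, one_mul]⟩
  -- notation for the continuum side
  set T : ℕ → Ω₀ → ℝ := fun k ω => mollifiedSILT Z₀ k ω with hTdef
  set μ : ℕ → ℝ := fun k => ∫ ω, T k ω ∂P₀ with hμ
  have hTbdd : ∀ k ω, ‖T k ω‖ ≤ k / (2 * Real.pi) := fun k ω => by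
    simp only [hTdef]; rw [hT k ω]; exact norm_mollify_le k _
  have hTm : ∀ k, Measurable (T k) := fun k => by
    have : T k = fun ω => (∫ s in Set.Icc (0 : ℝ) 1, ∫ t in Set.Icc (0 : ℝ) 1,
        gaussKernel k ((path₀ ω) (Set.projIcc (0 : ℝ) 1 zero_le_one s) -
          (path₀ ω) (Set.projIcc (0 : ℝ) 1 zero_le_one t))) := funext (hT k)
    rw [this]; exact (continuous_mollify k).measurable.comp hpath₀m
  have hTint : ∀ k, Integrable (T k) P₀ := fun k =>
    Integrable.of_bound (hTm k).aestronglyMeasurable (k / (2 * Real.pi)) (ae_of_all _ (hTbdd k))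
  have hTc_bdd : ∀ k ω, ‖T k ω - μ k‖ ≤ 2 * (k / (2 * Real.pi)) := fun k ω => by
    refine (norm_sub_le _ _).trans ?_
    have h1 := hTbdd k ω
    have h2 : ‖μ k‖ ≤ k / (2 * Real.pi) := by
      simp only [hμ]
      refine (norm_integral_le_integral_norm _).trans ?_
      refine (integral_mono_of_nonneg (ae_of_all _ fun _ => norm_nonneg _) (integrable_const _)
        (ae_of_all _ (hTbdd k))).trans ?_
      rw [integral_const, probReal_univ, one_smul]
    linarith
  -- integrability on the continuum side
  have hγint : Integrable γ₀ P₀ := hγ₀.integrable one_le_two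
  have hγsq : Integrable (fun ω => γ₀ ω ^ 2) P₀ := hγ₀.integrable_sq
  have hTc_memLp : ∀ k, MemLp (fun ω => T k ω - μ k) 2 P₀ := fun k =>
    MemLp.of_bound ((hTm k).sub measurable_const).aestronglyMeasurable _ (ae_of_all _ (hTc_bdd k))
  have hγTc : ∀ k, Integrable (fun ω => γ₀ ω * (T k ω - μ k)) P₀ := fun k => by
    have := hγ₀.integrable_mul (hTc_memLp k)
    exact this
  have hTcsq : ∀ k, Integrable (fun ω => (T k ω - μ k) ^ 2) P₀ := fun k =>
    Integrable.of_bound (((hTm k).sub measurable_const).pow_const 2).aestronglyMeasurable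
      ((2 * (k / (2 * Real.pi))) ^ 2) (ae_of_all _ fun ω => by
        rw [norm_pow]; exact pow_le_pow_left₀ (norm_nonneg _) (hTc_bdd k ω) 2)
  -- Donsker: `𝔼 Φ → μ_k`, `𝔼 Φ² → E T_k²`
  have hmean : ∀ k, Tendsto (fun n : ℕ => 𝔼 ω : StepSeq n, (∫ s in Set.Icc (0 : ℝ) 1, ∫ t in Set.Icc (0 : ℝ) 1,
        gaussKernel k ((scaledPath n ω) (Set.projIcc (0 : ℝ) 1 zero_le_one s) -
          (scaledPath n ω) (Set.projIcc (0 : ℝ) 1 zero_le_one t)))) atTop (𝓝 (μ k)) := by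
    intro k
    obtain ⟨Ψ, hΨ⟩ := hΨ k
    have h := tendsto_expect_scaledPath Ω₀ P₀ Z₀ hZ₀ hm₀ hc₀ Ψ
    convert h using 2 with n
    · exact Finset.expect_congr rfl fun ω _ => (hΨ _).symm
    · simp only [hμ, hTdef]
      refine integral_congr_ae (ae_of_all _ fun ω => ?_)
      change mollifiedSILT Z₀ k ω = Ψ _
      rw [hΨ, mollifiedSILT_eq_mollify_path Z₀ hc₀]
  have hsqlim : ∀ k, Tendsto (fun n : ℕ => 𝔼 ω : StepSeq n, (∫ s in Set.Icc (0 : ℝ) 1, ∫ t in Set.Icc (0 : ℝ) 1,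
        gaussKernel k ((scaledPath n ω) (Set.projIcc (0 : ℝ) 1 zero_le_one s) -
          (scaledPath n ω) (Set.projIcc (0 : ℝ) 1 zero_le_one t))) ^ 2) atTop
      (𝓝 (∫ ω, T k ω ^ 2 ∂P₀)) := by
    intro k
    obtain ⟨Ψ, hΨ⟩ := hΨ k
    have h := tendsto_expect_scaledPath Ω₀ P₀ Z₀ hZ₀ hm₀ hc₀ (Ψ * Ψ)
    convert h using 2 with n
    · refine Finset.expect_congr rfl fun ω _ => ?_
      rw [BoundedContinuousFunction.coe_mul, Pi.mul_apply, hΨ, sq]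
    · simp only [hTdef]
      refine integral_congr_ae (ae_of_all _ fun ω => ?_)
      change mollifiedSILT Z₀ k ω ^ 2 = (Ψ * Ψ) _
      rw [BoundedContinuousFunction.coe_mul, Pi.mul_apply, hΨ, mollifiedSILT_eq_mollify_path Z₀ hc₀, sq]
  -- hence `𝔼 (Φ - 𝔼Φ)² → E (T_k - μ_k)²`
  have hM : ∀ k, Tendsto (fun n : ℕ => 𝔼 ω : StepSeq n, ((∫ s in Set.Icc (0 : ℝ) 1, ∫ t in Set.Icc (0 : ℝ) 1,
        gaussKernel k ((scaledPath n ω) (Set.projIcc (0 : ℝ) 1 zero_le_one s) -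
          (scaledPath n ω) (Set.projIcc (0 : ℝ) 1 zero_le_one t))) - 𝔼 ω' : StepSeq n, (∫ s in Set.Icc (0 : ℝ) 1, ∫ t in Set.Icc (0 : ℝ) 1,
        gaussKernel k ((scaledPath n ω') (Set.projIcc (0 : ℝ) 1 zero_le_one s) -
          (scaledPath n ω') (Set.projIcc (0 : ℝ) 1 zero_le_one t)))) ^ 2) atTop
      (𝓝 (∫ ω, (T k ω - μ k) ^ 2 ∂P₀)) := by
    intro k
    have hTsq : Integrable (fun ω => T k ω ^ 2) P₀ :=
      Integrable.of_bound ((hTm k).pow_const 2).aestronglyMeasurable ((k / (2 * Real.pi)) ^ 2)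
        (ae_of_all _ fun ω => by rw [norm_pow]; exact pow_le_pow_left₀ (norm_nonneg _) (hTbdd k ω) 2)
    have hcont : ∫ ω, (T k ω - μ k) ^ 2 ∂P₀ = (∫ ω, T k ω ^ 2 ∂P₀) - μ k ^ 2 := by
      have h : (fun ω => (T k ω - μ k) ^ 2) = fun ω => (T k ω ^ 2 - 2 * μ k * T k ω) + μ k ^ 2 :=
        funext fun ω => by ring
      rw [h, integral_add (f := fun ω => T k ω ^ 2 - 2 * μ k * T k ω) (g := fun _ => μ k ^ 2)
        (hTsq.sub ((hTint k).const_mul _)) (integrable_const _),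
        integral_sub (f := fun ω => T k ω ^ 2) (g := fun ω => 2 * μ k * T k ω) hTsq
        ((hTint k).const_mul _), integral_const_mul, integral_const, probReal_univ, one_smul]
      simp only [hμ]; ring
    have hdisc : ∀ n : ℕ, 𝔼 ω : StepSeq n, ((∫ s in Set.Icc (0 : ℝ) 1, ∫ t in Set.Icc (0 : ℝ) 1,
        gaussKernel k ((scaledPath n ω) (Set.projIcc (0 : ℝ) 1 zero_le_one s) -
          (scaledPath n ω) (Set.projIcc (0 : ℝ) 1 zero_le_one t))) - 𝔼 ω' : StepSeq n, (∫ s in Set.Icc (0 : ℝ) 1, ∫ t in Set.Icc (0 : ℝ) 1,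
        gaussKernel k ((scaledPath n ω') (Set.projIcc (0 : ℝ) 1 zero_le_one s) -
          (scaledPath n ω') (Set.projIcc (0 : ℝ) 1 zero_le_one t)))) ^ 2 =
        𝔼 ω : StepSeq n, (∫ s in Set.Icc (0 : ℝ) 1, ∫ t in Set.Icc (0 : ℝ) 1,
        gaussKernel k ((scaledPath n ω) (Set.projIcc (0 : ℝ) 1 zero_le_one s) -
          (scaledPath n ω) (Set.projIcc (0 : ℝ) 1 zero_le_one t))) ^ 2 - (𝔼 ω' : StepSeq n, (∫ s in Set.Icc (0 : ℝ) 1, ∫ t in Set.Icc (0 : ℝ) 1,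
        gaussKernel k ((scaledPath n ω') (Set.projIcc (0 : ℝ) 1 zero_le_one s) -
          (scaledPath n ω') (Set.projIcc (0 : ℝ) 1 zero_le_one t)))) ^ 2 := fun n =>
      expect_sq_sub_expect (fun ω : StepSeq n => (∫ s in Set.Icc (0 : ℝ) 1, ∫ t in Set.Icc (0 : ℝ) 1,
        gaussKernel k ((scaledPath n ω) (Set.projIcc (0 : ℝ) 1 zero_le_one s) -
          (scaledPath n ω) (Set.projIcc (0 : ℝ) 1 zero_le_one t))))
    simp_rw [hdisc]
    rw [hcont]
    exact (hsqlim k).sub ((hmean k).pow 2)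
  -- and `𝔼 ((Φ - 𝔼Φ) - J̄/2)² → E (T̄_k - γ₀)²`
  set ρ : ℕ → ℝ := fun k => ∫ ω, ((T k ω - μ k) - γ₀ ω) ^ 2 ∂P₀ with hρ
  have he : ∀ k, Tendsto (fun n : ℕ => 𝔼 ω : StepSeq n,
      (((∫ s in Set.Icc (0 : ℝ) 1, ∫ t in Set.Icc (0 : ℝ) 1,
        gaussKernel k ((scaledPath n ω) (Set.projIcc (0 : ℝ) 1 zero_le_one s) -
          (scaledPath n ω) (Set.projIcc (0 : ℝ) 1 zero_le_one t))) - 𝔼 ω' : StepSeq n, (∫ s in Set.Icc (0 : ℝ) 1, ∫ t in Set.Icc (0 : ℝ) 1,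
        gaussKernel k ((scaledPath n ω') (Set.projIcc (0 : ℝ) 1 zero_le_one s) -
          (scaledPath n ω') (Set.projIcc (0 : ℝ) 1 zero_le_one t)))) - jbar n ω / 2) ^ 2) atTop (𝓝 (ρ k)) := by
    intro k
    have hdisc : ∀ n : ℕ, 𝔼 ω : StepSeq n, (((∫ s in Set.Icc (0 : ℝ) 1, ∫ t in Set.Icc (0 : ℝ) 1,
        gaussKernel k ((scaledPath n ω) (Set.projIcc (0 : ℝ) 1 zero_le_one s) -
          (scaledPath n ω) (Set.projIcc (0 : ℝ) 1 zero_le_one t))) - 𝔼 ω' : StepSeq n, (∫ s in Set.Icc (0 : ℝ) 1, ∫ t in Set.Icc (0 : ℝ) 1,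
        gaussKernel k ((scaledPath n ω') (Set.projIcc (0 : ℝ) 1 zero_le_one s) -
          (scaledPath n ω') (Set.projIcc (0 : ℝ) 1 zero_le_one t)))) - jbar n ω / 2) ^ 2 =
        𝔼 ω : StepSeq n, ((∫ s in Set.Icc (0 : ℝ) 1, ∫ t in Set.Icc (0 : ℝ) 1,
        gaussKernel k ((scaledPath n ω) (Set.projIcc (0 : ℝ) 1 zero_le_one s) -
          (scaledPath n ω) (Set.projIcc (0 : ℝ) 1 zero_le_one t))) - 𝔼 ω' : StepSeq n, (∫ s in Set.Icc (0 : ℝ) 1, ∫ t in Set.Icc (0 : ℝ) 1,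
        gaussKernel k ((scaledPath n ω') (Set.projIcc (0 : ℝ) 1 zero_le_one s) -
          (scaledPath n ω') (Set.projIcc (0 : ℝ) 1 zero_le_one t)))) ^ 2 -
          2 * 𝔼 ω : StepSeq n, (jbar n ω / 2) * ((∫ s in Set.Icc (0 : ℝ) 1, ∫ t in Set.Icc (0 : ℝ) 1,
        gaussKernel k ((scaledPath n ω) (Set.projIcc (0 : ℝ) 1 zero_le_one s) -
          (scaledPath n ω) (Set.projIcc (0 : ℝ) 1 zero_le_one t))) - 𝔼 ω' : StepSeq n, (∫ s in Set.Icc (0 : ℝ) 1, ∫ t in Set.Icc (0 : ℝ) 1,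
        gaussKernel k ((scaledPath n ω') (Set.projIcc (0 : ℝ) 1 zero_le_one s) -
          (scaledPath n ω') (Set.projIcc (0 : ℝ) 1 zero_le_one t)))) +
          𝔼 ω : StepSeq n, (jbar n ω / 2) ^ 2 := fun n =>
      expect_sq_centred_sub (fun ω : StepSeq n => (∫ s in Set.Icc (0 : ℝ) 1, ∫ t in Set.Icc (0 : ℝ) 1,
        gaussKernel k ((scaledPath n ω) (Set.projIcc (0 : ℝ) 1 zero_le_one s) -
          (scaledPath n ω) (Set.projIcc (0 : ℝ) 1 zero_le_one t)))) (fun ω => jbar n ω / 2)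
    have hcont : ρ k = (∫ ω, (T k ω - μ k) ^ 2 ∂P₀) -
        2 * (∫ ω, γ₀ ω * (T k ω - μ k) ∂P₀) + ∫ ω, γ₀ ω ^ 2 ∂P₀ := by
      simp only [hρ]
      have h : (fun ω => ((T k ω - μ k) - γ₀ ω) ^ 2) =
          fun ω => ((T k ω - μ k) ^ 2 - 2 * (γ₀ ω * (T k ω - μ k))) + γ₀ ω ^ 2 :=
        funext fun ω => by ring
      rw [h, integral_add (f := fun ω => (T k ω - μ k) ^ 2 - 2 * (γ₀ ω * (T k ω - μ k)))
        (g := fun ω => γ₀ ω ^ 2) ((hTcsq k).sub ((hγTc k).const_mul 2)) hγsq,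
        integral_sub (f := fun ω => (T k ω - μ k) ^ 2) (g := fun ω => 2 * (γ₀ ω * (T k ω - μ k)))
        (hTcsq k) ((hγTc k).const_mul 2), integral_const_mul]
    simp_rw [hdisc]
    rw [hcont]
    exact ((hM k).sub ((hα₂ k).const_mul 2)).add hα₁
  -- `ρ_k → 0` (Varadhan's `L²` convergence)
  have hρ0 : Tendsto ρ atTop (𝓝 0) := by
    have hF : ∀ k, MemLp (fun ω => (T k ω - μ k) - γ₀ ω) 2 P₀ := fun k => (hTc_memLp k).sub hγ₀
    have hρnn : ∀ k, 0 ≤ ρ k := fun k => integral_nonneg fun ω => sq_nonneg _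
    have heq : ∀ k, (eLpNorm (fun ω => (mollifiedSILT Z₀ k ω - ∫ ω', mollifiedSILT Z₀ k ω' ∂P₀) - γ₀ ω)
        2 P₀).toReal = Real.sqrt (ρ k) := by
      intro k
      have h := (hF k).eLpNorm_eq_integral_rpow_norm (by norm_num) (by norm_num)
      have h2 : (fun ω => (mollifiedSILT Z₀ k ω - ∫ ω', mollifiedSILT Z₀ k ω' ∂P₀) - γ₀ ω) =
          fun ω => (T k ω - μ k) - γ₀ ω := rfl
      have h3 : ∫ ω, ‖(T k ω - μ k) - γ₀ ω‖ ^ (2 : ℝ≥0∞).toReal ∂P₀ = ρ k := by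
        simp only [hρ, ENNReal.toReal_ofNat, Real.rpow_two, sq_abs, Real.norm_eq_abs]
      rw [h2, h, h3, ENNReal.toReal_ofReal (by positivity), Real.sqrt_eq_rpow]
      norm_num
    have h1 : Tendsto (fun k => Real.sqrt (ρ k)) atTop (𝓝 0) := by
      have := (ENNReal.tendsto_toReal ENNReal.zero_ne_top).comp hlim₀
      rw [ENNReal.toReal_zero] at this
      exact this.congr fun k => heq k
    have h2 := h1.pow 2
    simp only [zero_pow two_ne_zero] at h2
    exact h2.congr fun k => Real.sq_sqrt (hρnn k)
  -- bookkeeping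
  have hk : ∀ᶠ k : ℕ in atTop, ρ k < ε ^ 2 / 2 := (tendsto_order.1 hρ0).2 _ (by positivity)
  filter_upwards [hk] with k hk'
  have hn : ∀ᶠ n : ℕ in atTop, 𝔼 ω : StepSeq n,
      (((∫ s in Set.Icc (0 : ℝ) 1, ∫ t in Set.Icc (0 : ℝ) 1,
        gaussKernel k ((scaledPath n ω) (Set.projIcc (0 : ℝ) 1 zero_le_one s) -
          (scaledPath n ω) (Set.projIcc (0 : ℝ) 1 zero_le_one t))) - 𝔼 ω' : StepSeq n, (∫ s in Set.Icc (0 : ℝ) 1, ∫ t in Set.Icc (0 : ℝ) 1,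
        gaussKernel k ((scaledPath n ω') (Set.projIcc (0 : ℝ) 1 zero_le_one s) -
          (scaledPath n ω') (Set.projIcc (0 : ℝ) 1 zero_le_one t)))) - jbar n ω / 2) ^ 2 < ε ^ 2 :=
    (tendsto_order.1 (he k)).2 _ (by nlinarith)
  filter_upwards [hn] with n hn'
  refine (expect_abs_le_sqrt_expect_sq _).trans ?_
  rw [← Real.sqrt_sq hε.le]
  exact Real.sqrt_le_sqrt hn'.le

/-- **Stoll's invariance principle from the limits of the second moments of the discrete
self-intersection local time** (the residual content of core (α)): with Donsker's theorem,
Varadhan's renormalisation and the Gibbs-tilt glue all PROVED, the named fact follows from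
(α₁) `E(J̄_n/2)² → E γ²` and (α₂) `E[(J̄_n/2)(Φ_k(W̄_n) - ⟨Φ_k(W̄_n)⟩)] → E[γ T̄_k]` (`k` fixed,
`n → ∞`) for one planar Brownian motion `Z₀` with `L²` renormalised self-intersection local time
`γ` — two local-limit computations for the planar simple random walk which remain to be
formalised. [cite: Stoll1989, §2 and §3] -/
theorem Stoll1989_invariance_of_secondMomentLimits {Ω₀ : Type u} [MeasurableSpace Ω₀]
    (P₀ : Measure Ω₀) [IsProbabilityMeasure P₀] (Z₀ : ℝ≥0 → Ω₀ → ℂ)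
    (hZ₀ : IsBrownianComplex Z₀ P₀) (hm₀ : ∀ t, Measurable (Z₀ t)) (hc₀ : ∀ ω, Continuous (Z₀ · ω))
    (γ₀ : Ω₀ → ℝ) (hγ₀ : MemLp γ₀ 2 P₀)
    (hlim₀ : Tendsto (fun k : ℕ => eLpNorm (fun ω =>
      (mollifiedSILT Z₀ k ω - ∫ ω', mollifiedSILT Z₀ k ω' ∂P₀) - γ₀ ω) 2 P₀) atTop (𝓝 0))
    (hα₁ : Tendsto (fun n : ℕ => 𝔼 ω : StepSeq n, (jbar n ω / 2) ^ 2) atTop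
      (𝓝 (∫ ω, γ₀ ω ^ 2 ∂P₀)))
    (hα₂ : ∀ k : ℕ, Tendsto (fun n : ℕ => 𝔼 ω : StepSeq n, (jbar n ω / 2) *
        ((∫ s in Set.Icc (0 : ℝ) 1, ∫ t in Set.Icc (0 : ℝ) 1,
        gaussKernel k ((scaledPath n ω) (Set.projIcc (0 : ℝ) 1 zero_le_one s) -
          (scaledPath n ω) (Set.projIcc (0 : ℝ) 1 zero_le_one t))) - 𝔼 ω' : StepSeq n, (∫ s in Set.Icc (0 : ℝ) 1, ∫ t in Set.Icc (0 : ℝ) 1,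
        gaussKernel k ((scaledPath n ω') (Set.projIcc (0 : ℝ) 1 zero_le_one s) -
          (scaledPath n ω') (Set.projIcc (0 : ℝ) 1 zero_le_one t))))) atTop
      (𝓝 (∫ ω, γ₀ ω * (mollifiedSILT Z₀ k ω - ∫ ω', mollifiedSILT Z₀ k ω' ∂P₀) ∂P₀))) :
    Stoll1989_invariance.{u} :=
  Stoll1989_invariance_of_mollify
    (mollify_of_secondMomentLimits P₀ Z₀ hZ₀ hm₀ hc₀ γ₀ hγ₀ hlim₀ hα₁ hα₂)

end Edwards2D

end Literature.Barriers.CriticalPhenomena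

end
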